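import Summits.Schanuel.Schanuel.Theorems.ZilberEacTransversalLimits
import Summits.Schanuel.Schanuel.Theorems.ZilberEacExplosionDominance
import Literature.ModelTheory.Zilber.EACDensityOscillatory
import HarnessLib

/-!
# The invariant-direction regime with an OSCILLATORY transversal: real hyperplanes with an integer
# relation (O51 (a) = O49 (a): the rational-`λ` families where THEOREM J is silent)

Zilber's Exponential-Algebraic Closedness, case ladder (host summit Schanuel, cell `pub-schanuel`,
seat 2, gen 11).  `ZilberEacInvariantDirectionDensity` proves `I(W ∩ Γ_exp) = I(W)` for
`W = polyFibredGraph g A f` over a base invariant under a lattice direction `q` as soon as the limit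
family `U = {(e^{g(r_p)}, r_p)}`, `r_p = 2πi p + log a`, supports no nonzero polynomial, and
supplies this genericity when some transversal lattice ray EXPLODES or DECAYS (`Re g_D(2πiℓ₀) ≠ 0`).
For a REAL HYPERPLANE base `x_{s+1} = Σ rᵢ xᵢ + c` (`rᵢ ∈ ℝ`) every lattice ray is oscillatory:
`Re g(2πi ℓ) = Re c` — the power coordinate has CONSTANT modulus on `U` and only its PHASE
`e^{2πi Σ rᵢ pᵢ}` moves.  This file supplies the matching genericity:

* `invariantDirection_limits_generic_of_rotation` — if `e^{g(x + 2πiℓ)} = ζ e^{g(x)}` with `|ζ| = 1`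
  not a root of unity, then `U` is generic: along `p = p' + nℓ` the values `e^{g(r_p)} = c₀ ζⁿ` form
  a non-periodic ROTATION, the relation `G(c₀ζⁿ, r' + n v) = 0` forces the leading `Y`-coefficient
  `h(W) = c_d(W, r')` of the line substitution to satisfy `h(c₀ζⁿ) → 0`, so the rotation would
  cluster in the roots of `h` — impossible (`EACDensityOscillatory.not_clusterIn_rotation`, the
  pigeonhole of seat 1's oscillatory surfaces); `p'` is chosen off the zero set of a coefficient of
  `c_d` (`exists_int_eval_translate_ne_zero`);
* the density theorems and the example of O49 (a) (`x₂ = √2(x₀ - x₁)`) are in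
  `ZilberEacRealHyperplaneInvariant`.

HONEST FRAMING: explicit families inside an OPEN cell; `EC(3,2)` OPEN; NOT Schanuel's conjecture;
EAC ⇏ SC.
-/

noncomputable section

open Complex MvPolynomial Filter Topology
open Literature.NumberTheory.Transcendental Literature.ModelTheory.Zilber
  Literature.ModelTheory.ExponentialFields

set_option linter.dupNamespace false

namespace Summit.Schanuel.Schanuel.Theorems

/-! ## Part A. Genericity of the limit family from a non-periodic rotation -/

section Rotation

variable {t : ℕ}

/-- **Genericity of the limit family (rotation).**  If `e^{g(x + 2πiℓ)} = ζ e^{g(x)}` for all `x`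
with `|ζ| = 1`, `ζ` not a root of unity, then for every `L` no nonzero `G ∈ ℂ[W, R₀..R_{t-1}]`
vanishes at `(e^{g(r_p)}, r_p)` for all `r_p = 2πi p + L`, `p ∈ ℤ^t`. (new) -/
theorem invariantDirection_limits_generic_of_rotation (g : MvPolynomial (Fin t) ℂ) (ℓ : Fin t → ℤ)
    (ζ : ℂ) (hζ1 : ‖ζ‖ = 1) (hroot : ∀ j : ℕ, 0 < j → ζ ^ j ≠ 1)
    (hshift : ∀ x : Fin t → ℂ,
      exp (eval (x + fun i => 2 * Real.pi * I * (ℓ i : ℂ)) g) = ζ * exp (eval x g))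
    (L : Fin t → ℂ) (G : MvPolynomial (Fin (t + 1)) ℂ) (hG : G ≠ 0) :
    ∃ p : Fin t → ℤ, eval (Fin.cons (exp (eval (fun j => 2 * Real.pi * I * (p j : ℂ) + L j) g))
      (fun j => 2 * Real.pi * I * (p j : ℂ) + L j) : Fin (t + 1) → ℂ) G ≠ 0 := by
  classical
  by_contra hcon
  push Not at hcon
  -- the direction, the line substitution, its leading `Y`-coefficient `c` and a generic `W`-coefficient
  set v : Fin t → ℂ := fun i => 2 * Real.pi * I * (ℓ i : ℂ) with hv
  have hexpand : ∀ w r y, eval (Fin.cons w (r + y • v) : Fin (t + 1) → ℂ) G = _ :=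
    fun w r y => eval_cons_add_smul G v w r y
  have hne := aeval_lineShift_ne_zero G hG v
  generalize hGq : (aeval (Fin.cons (Polynomial.C (X 0))
      (fun i => Polynomial.C (X i.succ) + Polynomial.C (C (v i)) * Polynomial.X) :
      Fin (t + 1) → Polynomial (MvPolynomial (Fin (t + 1)) ℂ)) G) = Gq at hexpand hne
  set d : ℕ := Gq.natDegree with hd
  set cW : Polynomial (MvPolynomial (Fin t) ℂ) := finSuccEquiv ℂ t Gq.leadingCoeff with hcW
  have hcW0 : cW ≠ 0 := by
    rw [hcW]
    exact fun h => (Polynomial.leadingCoeff_ne_zero.2 hne) ((finSuccEquiv ℂ t).injective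
      (by rw [h, map_zero]))
  have hcj : cW.leadingCoeff ≠ 0 := Polynomial.leadingCoeff_ne_zero.2 hcW0
  obtain ⟨p', hp'⟩ := exists_int_eval_translate_ne_zero hcj L (a := 2 * Real.pi * I)
    Complex.two_pi_I_ne_zero
  set r' : Fin t → ℂ := fun j => 2 * Real.pi * I * (p' j : ℂ) + L j with hr'
  have hr'eq : (fun i => L i + 2 * Real.pi * I * (p' i : ℂ)) = r' := by
    funext i; simp only [hr']; ring
  rw [hr'eq] at hp'
  -- the univariate polynomial `h(W) = c(W, r')`
  set h : Polynomial ℂ := cW.map (eval r') with hh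
  have hh0 : h ≠ 0 := by
    intro h0
    apply hp'
    have := congrArg (fun P => P.coeff cW.natDegree) h0
    simp only [hh, Polynomial.coeff_map, Polynomial.coeff_zero] at this
    exact this
  have hheval : ∀ w : ℂ, eval (Fin.cons w r' : Fin (t + 1) → ℂ) Gq.leadingCoeff = h.eval w := by
    intro w
    rw [hh, hcW, MvPolynomial.eval_eq_eval_mv_eval']
  -- the rotation `w_n = e^{g(r' + n v)} = c₀ ζ^n`
  set c₀ : ℂ := exp (eval r' g) with hc₀
  have hc₀0 : c₀ ≠ 0 := Complex.exp_ne_zero _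
  set w : ℕ → ℂ := fun n => exp (eval (r' + (n : ℂ) • v) g) with hw
  have hwrot : ∀ n, w n = c₀ * ζ ^ n := by
    intro n
    induction n with
    | zero => simp [hw, hc₀]
    | succ n ih =>
      have e : r' + ((n + 1 : ℕ) : ℂ) • v = (r' + (n : ℂ) • v) + v := by
        push_cast; rw [add_smul, one_smul, add_assoc]
      simp only [hw] at ih ⊢
      rw [e, hv, hshift, ← hv, ih, pow_succ]
      ring
  have hwnorm : ∀ n, ‖w n‖ = ‖c₀‖ := fun n => by
    rw [hwrot, norm_mul, norm_pow, hζ1, one_pow, mul_one]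
  -- the relation along `p = p' + n ℓ`
  have hrel : ∀ n : ℕ, eval (Fin.cons (w n) (r' + (n : ℂ) • v) : Fin (t + 1) → ℂ) G = 0 := by
    intro n
    have e : (r' + (n : ℂ) • v) = fun j => 2 * Real.pi * I * (((p' j + (n : ℤ) * ℓ j : ℤ)) : ℂ) + L j := by
      funext j
      simp only [hr', hv, Pi.add_apply, Pi.smul_apply, smul_eq_mul]
      push_cast; ring
    have := hcon (fun j => p' j + (n : ℤ) * ℓ j)
    rw [← e] at this
    exact this
  -- bounds for the lower coefficients on the circle `‖w‖ = ‖c₀‖`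
  have hbd : ∀ k, ∃ B : ℝ, ∀ n, ‖eval (Fin.cons (w n) r' : Fin (t + 1) → ℂ) (Gq.coeff k)‖ ≤ B := by
    intro k
    obtain ⟨C, hC, N, hCN⟩ :=
      Literature.NumberTheory.Transcendental.HypersurfaceCover.exists_norm_eval_le_pow (Gq.coeff k)
    refine ⟨C * (1 + (‖c₀‖ + ‖r'‖)) ^ N, fun n => (hCN _).trans ?_⟩
    refine mul_le_mul_of_nonneg_left (pow_le_pow_left₀ (by positivity) ?_ _) hC
    have : ‖(Fin.cons (w n) r' : Fin (t + 1) → ℂ)‖ ≤ ‖c₀‖ + ‖r'‖ := by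
      refine (pi_norm_le_iff_of_nonneg (by positivity)).2 fun i => ?_
      refine Fin.cases ?_ (fun j => ?_) i
      · rw [Fin.cons_zero, hwnorm]; linarith [norm_nonneg r']
      · rw [Fin.cons_succ]; linarith [norm_le_pi_norm r' j, norm_nonneg c₀]
    linarith
  choose B hB using hbd
  set Bt : ℝ := ∑ k ∈ Finset.range d, |B k| with hBt
  -- `h(w_n) → 0`
  have hsmall : ∀ n : ℕ, 1 ≤ n → ‖h.eval (w n)‖ * n ≤ d * Bt := by
    intro n hn1
    have hn : (1 : ℝ) ≤ n := by exact_mod_cast hn1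
    have hrel' := hrel n
    rw [hexpand, Polynomial.eval_eq_sum_range'
      ((Polynomial.natDegree_map_le).trans_lt (Nat.lt_succ_self _)), Finset.sum_range_succ] at hrel'
    simp only [Polynomial.coeff_map] at hrel'
    rw [← hd] at hrel'
    have htop : eval (Fin.cons (w n) r' : Fin (t + 1) → ℂ) (Gq.coeff d) * (n : ℂ) ^ d =
        -∑ k ∈ Finset.range d, eval (Fin.cons (w n) r' : Fin (t + 1) → ℂ) (Gq.coeff k) * (n : ℂ) ^ k := by
      linear_combination hrel'
    have hcoef : Gq.coeff d = Gq.leadingCoeff := by rw [hd]; rfl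
    rw [hcoef, hheval] at htop
    have hnd : (0 : ℝ) < (n : ℝ) ^ d := pow_pos (by linarith) d
    -- `‖h(w_n)‖ n^d ≤ Σ_{k<d} |B k| n^k ≤ d Bt n^{d-1}`, multiplied through by `n`
    have h1 : ‖h.eval (w n)‖ * (n : ℝ) ^ d ≤ ∑ k ∈ Finset.range d, |B k| * (n : ℝ) ^ k := by
      have := congrArg (fun z => ‖z‖) htop
      simp only [norm_mul, norm_pow, Complex.norm_natCast, norm_neg] at this
      rw [this]
      refine (norm_sum_le _ _).trans (Finset.sum_le_sum fun k _ => ?_)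
      rw [norm_mul, norm_pow, Complex.norm_natCast]
      exact mul_le_mul_of_nonneg_right ((hB k n).trans (le_abs_self _)) (pow_nonneg (by linarith) _)
    have h2 : ∀ k ∈ Finset.range d, |B k| * (n : ℝ) ^ k * n ≤ |B k| * (n : ℝ) ^ d := by
      intro k hk
      have hk' : k + 1 ≤ d := Finset.mem_range.1 hk
      have hpow : (n : ℝ) ^ (k + 1) ≤ (n : ℝ) ^ d := pow_le_pow_right₀ hn hk'
      rw [pow_succ] at hpow
      have := abs_nonneg (B k)
      nlinarith
    have h3 : (∑ k ∈ Finset.range d, |B k| * (n : ℝ) ^ k) * n ≤ d * Bt * (n : ℝ) ^ d := by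
      rw [Finset.sum_mul]
      calc ∑ k ∈ Finset.range d, |B k| * (n : ℝ) ^ k * n ≤ ∑ k ∈ Finset.range d, |B k| * (n : ℝ) ^ d :=
            Finset.sum_le_sum h2
        _ = Bt * (n : ℝ) ^ d := by rw [hBt, Finset.sum_mul]
        _ ≤ d * Bt * (n : ℝ) ^ d := by
            have hBt0 : 0 ≤ Bt := Finset.sum_nonneg fun k _ => abs_nonneg _
            have hd1 : Bt ≤ d * Bt ∨ d = 0 := by
              rcases Nat.eq_zero_or_pos d with h0 | hpos
              · exact Or.inr h0
              · left
                have : (1 : ℝ) ≤ d := by exact_mod_cast hpos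
                nlinarith
            rcases hd1 with hle | h0
            · exact mul_le_mul_of_nonneg_right hle hnd.le
            · simp [hBt, h0]
    have h4 : ‖h.eval (w n)‖ * n * (n : ℝ) ^ d ≤ d * Bt * (n : ℝ) ^ d := by
      calc ‖h.eval (w n)‖ * n * (n : ℝ) ^ d = ‖h.eval (w n)‖ * (n : ℝ) ^ d * n := by ring
        _ ≤ (∑ k ∈ Finset.range d, |B k| * (n : ℝ) ^ k) * n :=
            mul_le_mul_of_nonneg_right h1 (by linarith)
        _ ≤ d * Bt * (n : ℝ) ^ d := h3
    exact le_of_mul_le_mul_right h4 hnd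
  have htend : Tendsto (fun n => ‖h.eval (w n)‖) atTop (𝓝 0) := by
    have hlim : Tendsto (fun n : ℕ => d * Bt / (n : ℝ)) atTop (𝓝 0) :=
      tendsto_const_nhds.div_atTop tendsto_natCast_atTop_atTop
    refine squeeze_zero_norm' ?_ hlim
    filter_upwards [eventually_ge_atTop 1] with n hn
    rw [norm_norm, le_div_iff₀ (by exact_mod_cast (show 0 < n by omega))]
    exact hsmall n hn
  have hcl := clusterIn_roots_of_tendsto hh0 htend
  exact not_clusterIn_rotation hc₀0 hζ1 hroot hwrot _ hcl

end Rotation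

end Summit.Schanuel.Schanuel.Theorems

end
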